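import Summits.CriticalPhenomena.PercolationContinuityZ3.Theorems.PercNearOneGluingNoHeavyLowerTailSunflowerPhiZeroPairFull

/-!
# (RES0′) for two petals from the three cell/face budgets (model form, kernel)

Corollary of `phi0_pair_model` (prove-1 gen 54): for `τ, σ, s ∈ (0,1)`, `0 < α₀₀ ≤ α₀₁ ≤ α₁₁`, a leaf-leaf constant
`c₀ ≥ τσ + (1−s)(1−τ)α₀₀`, and two petals `α₀₀ ≤ y_j ≤ k_j ≤ 1`, `α₀₁ ≤ g_j ≤ min(k_j,h_j)`, `α₁₁ ≤ h_j`, the budgets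
(BȲ) `Ȳ₁Ȳ₂ ≤ b_Ȳ`, (Bk) `k₁k₂ ≤ α₀₁`, (Bh) `h₁h₂ ≤ α₁₁` give `G₁G₂ ≤ g·(c₀ + p + q)` — the `n = 2` case of (RES0′) with no H-face budget
and no cap on `h` (prove-1 g52 §1 proved the `n = 2` case on paper from the four cell budgets; this is the kernel version via Φ₀ᴳ, whose
`n = 2` case is true although `Phi0Conj` is false for `n ≥ 5`, `not_phi0Conj'`). [this work]
-/

namespace Summit.CriticalPhenomena.PercolationContinuityZ3.Theorems.SunflowerPartition.SafeCalc.LinkedCurrency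

set_option maxHeartbeats 800000 in
/-- **(RES0′) for `n = 2`** from (BȲ), (Bk), (Bh) (see the module docstring). [this work] -/
theorem res0_two {τ σ s α00 α01 α11 c0 y₁ y₂ k₁ k₂ g₁ g₂ h₁ h₂ : ℝ} (hτ0 : 0 < τ) (hτ1 : τ < 1) (hσ0 : 0 < σ)
    (hσ1 : σ < 1) (hs0 : 0 < s) (hs1 : s < 1) (hα00 : 0 < α00) (h01 : α00 ≤ α01) (h11 : α01 ≤ α11)
    (hc0 : τ * σ + (1 - s) * (1 - τ) * α00 ≤ c0) (hy1 : α00 ≤ y₁) (hyk1 : y₁ ≤ k₁) (hk1 : k₁ ≤ 1) (hg1 : α01 ≤ g₁)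
    (hgk1 : g₁ ≤ k₁) (hgh1 : g₁ ≤ h₁) (hh1 : α11 ≤ h₁) (hy2 : α00 ≤ y₂) (hyk2 : y₂ ≤ k₂) (hk2 : k₂ ≤ 1) (hg2 : α01 ≤ g₂)
    (hgk2 : g₂ ≤ k₂) (hgh2 : g₂ ≤ h₂) (hh2 : α11 ≤ h₂)
    (hBY : ((1 - s) * y₁ + s * k₁) * ((1 - s) * y₂ + s * k₂) ≤ (1 - s) * α00 + s * α01)
    (hBk : k₁ * k₂ ≤ α01) (hBh : h₁ * h₂ ≤ α11) :
    (c0 + τ * (1 - σ) * ((1 - s) * y₁ + s * k₁) + s * (1 - τ) * ((1 - σ) * g₁ + σ * h₁)) *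
      (c0 + τ * (1 - σ) * ((1 - s) * y₂ + s * k₂) + s * (1 - τ) * ((1 - σ) * g₂ + σ * h₂)) ≤
    (c0 + τ * (1 - σ) * ((1 - s) * α00 + s * α01) + s * (1 - τ) * ((1 - σ) * α01 + σ * α11)) *
      (c0 + τ * (1 - σ) + s * (1 - τ)) := by
  obtain ⟨hα01, hα11⟩ : 0 < α01 ∧ 0 < α11 := ⟨lt_of_lt_of_le hα00 h01, lt_of_lt_of_le (lt_of_lt_of_le hα00 h01) h11⟩
  have hp0 : 0 < τ * (1 - σ) := mul_pos hτ0 (sub_pos.2 hσ1)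
  have hq0 : 0 < s * (1 - τ) := mul_pos hs0 (sub_pos.2 hτ1)
  have hbY0 : 0 < (1 - s) * α00 + s * α01 := by nlinarith [mul_pos (sub_pos.2 hs1) hα00, mul_pos hs0 hα01]
  have hbH0 : 0 < (1 - σ) * α01 + σ * α11 := by nlinarith [mul_pos (sub_pos.2 hσ1) hα01, mul_pos hσ0 hα11]
  have hg0 : 0 < c0 + τ * (1 - σ) * ((1 - s) * α00 + s * α01) + s * (1 - τ) * ((1 - σ) * α01 + σ * α11) := by
    nlinarith [mul_pos hp0 hbY0, mul_pos hq0 hbH0, mul_pos hτ0 hσ0, mul_pos (mul_pos (sub_pos.2 hs1) (sub_pos.2 hτ1)) hα00]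
  -- the budget step: gΦ₀ᴳ ≤ a
  have hX : τ * (1 - σ) * (((1 - s) * y₁ + s * k₁) * ((1 - s) * y₂ + s * k₂)) / ((1 - s) * α00 + s * α01) ≤ τ * (1 - σ) := by
    rw [div_le_iff₀ hbY0]; nlinarith [mul_le_mul_of_nonneg_left hBY hp0.le]
  have hK : k₁ * k₂ / (α01 * α01) ≤ 1 / α01 := by
    rw [div_le_div_iff₀ (mul_pos hα01 hα01) hα01]; nlinarith [mul_le_mul_of_nonneg_left hBk hα01.le]
  have hR : h₁ * h₂ / (α01 * α11) ≤ 1 / α01 := by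
    rw [div_le_div_iff₀ (mul_pos hα01 hα11) hα01]; nlinarith [mul_le_mul_of_nonneg_left hBh hα01.le]
  have hM : max (k₁ * k₂ / (α01 * α01)) (h₁ * h₂ / (α01 * α11)) ≤ 1 / α01 := max_le hK hR
  have hG : s * (1 - τ) * (1 - σ) * α01 * max (k₁ * k₂ / (α01 * α01)) (h₁ * h₂ / (α01 * α11)) ≤ s * (1 - τ) * (1 - σ) := by
    have := mul_le_mul_of_nonneg_left hM (mul_nonneg (mul_nonneg hq0.le (sub_pos.2 hσ1).le) hα01.le)
    have e : s * (1 - τ) * (1 - σ) * α01 * (1 / α01) = s * (1 - τ) * (1 - σ) := by field_simp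
    linarith
  have hH : s * (1 - τ) * σ * (h₁ * h₂) / α11 ≤ s * (1 - τ) * σ := by
    rw [div_le_iff₀ hα11]; nlinarith [mul_le_mul_of_nonneg_left hBh (mul_nonneg hq0.le hσ0.le)]
  have hsum : c0 + τ * (1 - σ) * (((1 - s) * y₁ + s * k₁) * ((1 - s) * y₂ + s * k₂)) / ((1 - s) * α00 + s * α01) +
      s * (1 - τ) * (1 - σ) * α01 * max (k₁ * k₂ / (α01 * α01)) (h₁ * h₂ / (α01 * α11)) + s * (1 - τ) * σ * (h₁ * h₂) / α11 ≤
      c0 + τ * (1 - σ) + s * (1 - τ) := by nlinarith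
  have hpair := phi0_pair_model hτ0 hτ1 hσ0 hσ1 hs0 hs1 hα00 h01 h11 hc0 hy1 hyk1 hk1 hg1 hgk1 hgh1 hh1 hy2 hyk2 hk2 hg2
    hgk2 hgh2 hh2
  exact hpair.trans (mul_le_mul_of_nonneg_left hsum hg0.le)

end Summit.CriticalPhenomena.PercolationContinuityZ3.Theorems.SunflowerPartition.SafeCalc.LinkedCurrency
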